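import Literature.NumberTheory.Automorphic.HilbertPartialHasseWeightShifting
import Mathlib.NumberTheory.NumberField.Discriminant.Different
import Mathlib.RingTheory.Valuation.Integral
import Mathlib.FieldTheory.PrimitiveElement
import Mathlib.LinearAlgebra.FreeModule.Finite.Matrix
import Mathlib.Algebra.Algebra.Hom.Rat
import HarnessLib

/-!
# The Frobenius permutation of the embeddings of a totally real field at an unramified prime

Proofs attached to `Literature.NumberTheory.Automorphic.HilbertPartialHasseWeightShifting`
(Emerton–Reduzzi–Xiao 2017, §3.1): the bookkeeping of the partial Hasse invariants is indexed
by the set `Σ` of embeddings `τ : 𝓞 L / p → 𝔽`, which for `p` **unramified** in `L` is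
identified, through `ι : ℚ̄_p ≃ ℂ`, with the set of embeddings `L →+* ℂ`, the arithmetic
Frobenius `σ` of `𝔽` acting on `Σ` by `τ ↦ σ ∘ τ` (ERX §3.1, first paragraph: "The chosen
embedding `ℚ̄ → ℚ̄_p` allows us to identify `Σ` with the set of `p`-adic embeddings `F → ℚ̄_p`,
and hence with the set of ring homomorphisms from `𝓞_F/(p)` to `𝔽`").  The named fact records
this action as a function `Fr` with `IsFrobeniusTwist p ι β (Fr β)` for all `β`.  This file
PROVES that identification — the reduction map `(L →+* ℚ̄_p) → (𝓞 L →+* ℤ̄_p/𝔪)` is a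
bijection when `p ∤ disc L` — and derives the existence, uniqueness and bijectivity of `Fr`:

* `PadicAlgCl.norm_le_one_of_isIntegral` — algebraic integers of `ℚ̄_p` lie in the closed unit
  ball (the valuation ring is integrally closed; Mathlib `Valuation.Integers`);
  `PadicAlgCl.charP_residueField` — the residue field `ℤ̄_p/𝔪` has characteristic `p`.
* `ringHom_padicAlgCl_ext_of_forall_norm_sub_lt_one` (injectivity) — two embeddings
  `L →+* ℚ̄_p` which are congruent modulo `𝔪` on `𝓞 L` coincide, provided `p ∤ disc L`
  (Dedekind: `p ∤ disc L` iff every prime of `𝓞 L` above `p` is unramified, Mathlib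
  `NumberField.not_dvd_discr_iff_forall_mem`; an unramified localisation is formally unramified
  over `ℤ`, and formally unramified algebras have unique lifts modulo any ideal `I` with
  `⋂ Iⁿ = 0`, Mathlib `Algebra.FormallyUnramified.ext_of_iInf`, applied to the ideal
  `{‖x‖ ≤ r}` of `ℤ̄_p` for some `r < 1`).
* `natCard_ringHom_padicAlgCl`, `natCard_ringHom_ringOfIntegers_le` (counting) — `L` has
  `[L:ℚ]` embeddings into `ℚ̄_p` (Mathlib `AlgHom.card`) and `𝓞 L` at most `[L:ℚ]` ring
  homomorphisms to any domain (Dedekind's independence of characters over `ℤ`, Mathlib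
  `card_algHom_le_finrank`, `RingOfIntegers.rank`); hence the reduction map is bijective and
  `exists_isFrobeniusTwist`, `exists_forall_isFrobeniusTwist`: **the `Fr` quantified in the
  fact exists** (no Hensel lifting is needed for this counting argument).
* `IsFrobeniusTwist.unique` — the Frobenius twist `Fr β` of `β` is unique;
  `IsFrobeniusTwist.eq_of_eq` — `β` is recovered from `Fr β` (Frobenius is injective on the
  residue field); hence `injective_of_forall_isFrobeniusTwist`,
  `bijective_of_forall_isFrobeniusTwist`: any `Fr` as in the hypothesis of
  `HilbertPartialHasseWeightShifting` is a permutation of `L →+* ℂ` (so that the weight shift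
  `β ↦ p·M (Fr β) - M β` of the fact is the vector `Σ_τ M_τ (p e_{Fr⁻¹ τ} - e_τ)` of the
  source, ERX §3.1 Remark 3.1.1), and `sum_weightShift_eq`:
  `Σ_β (p·M (Fr β) - M β) = (p - 1) Σ_β M β` (the parallel degree of `∏_τ h_τ^{M_τ}`).

What is NOT here: the discharge `HilbertPartialHasseWeightShifting_holds` itself, whose
printed proof (ERX §3.1, §4.2 Lemma 4.2.2, §4.3; Reduzzi–Xiao 2017 §4.2; Deligne–Serre 6.11)
lives on integral models of Hilbert modular varieties, their automorphic line bundles,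
partial Hasse invariants and coherent cohomology — objects absent from Mathlib and from the
tree (which models Hilbert eigenforms only as regular algebraic cuspidal `π` on `GL₂(𝔸_L)`).

No new definitions and no new named facts (D-0026); Mathlib anchors: `PadicAlgCl`
(`Mathlib/NumberTheory/Padics/Complex`), `Valuation.Integers.isIntegral_iff_v_le_one`,
`NumberField.not_dvd_discr_iff_forall_mem`, `Algebra.IsUnramifiedAt`,
`Algebra.FormallyUnramified.ext_of_iInf`, `IsLocalization.lift`, `AlgHom.card`,
`card_algHom_le_finrank`, `Function.Injective.bijective_of_nat_card_le`.

## References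

* M. Emerton, D. Reduzzi, L. Xiao, *Galois representations and torsion in the coherent
  cohomology of Hilbert modular varieties*, J. reine angew. Math. 726 (2017), §3.1
  (arXiv:1307.8003). [EmertonReduzziXiao2017]
* Background (extensions of valuations, Hensel's lemma, unramified extensions, Dedekind's
  independence of characters): standard; the proofs below only use the Mathlib anchors listed
  above. [folklore]
-/
noncomputable section

open scoped NumberField NNReal
open NumberField

namespace Literature.NumberTheory.Automorphic

/-! ### The closed unit ball of `ℚ̄_p` -/

section PadicAlgClIntegers

variable (p : ℕ) [Fact p.Prime]

/-- Membership in the valuation ring of `ℚ̄_p` is `‖x‖ ≤ 1`. [folklore] -/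
theorem PadicAlgCl.mem_valuationSubring_iff (x : PadicAlgCl p) :
    x ∈ (Valued.v (R := PadicAlgCl p)).valuationSubring ↔ ‖x‖ ≤ 1 := by
  rw [Valuation.mem_valuationSubring_iff, PadicAlgCl.valuation_def, ← NNReal.coe_le_coe,
    coe_nnnorm, NNReal.coe_one]

/-- Membership in the maximal ideal of the valuation ring of `ℚ̄_p` is `‖x‖ < 1`. [folklore] -/
theorem PadicAlgCl.mem_maximalIdeal_iff (x : (Valued.v (R := PadicAlgCl p)).valuationSubring) :
    x ∈ IsLocalRing.maximalIdeal _ ↔ ‖(x : PadicAlgCl p)‖ < 1 := by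
  rw [IsLocalRing.mem_maximalIdeal, mem_nonunits_iff]
  constructor
  · intro h
    by_contra hlt
    have h1 : ‖(x : PadicAlgCl p)‖ = 1 :=
      le_antisymm ((PadicAlgCl.mem_valuationSubring_iff p _).1 x.2) (not_lt.1 hlt)
    have hx0 : (x : PadicAlgCl p) ≠ 0 := by
      intro h0; rw [h0, norm_zero] at h1; exact zero_ne_one h1
    have hinv : (x : PadicAlgCl p)⁻¹ ∈ (Valued.v (R := PadicAlgCl p)).valuationSubring := by
      rw [PadicAlgCl.mem_valuationSubring_iff, norm_inv, h1, inv_one]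
    refine h ⟨⟨x, ⟨(x : PadicAlgCl p)⁻¹, hinv⟩, ?_, ?_⟩, rfl⟩
    · exact Subtype.ext (mul_inv_cancel₀ hx0)
    · exact Subtype.ext (inv_mul_cancel₀ hx0)
  · intro h hu
    obtain ⟨u, rfl⟩ := hu
    have h1 : ‖((u : (Valued.v (R := PadicAlgCl p)).valuationSubring) : PadicAlgCl p)‖ *
        ‖((u⁻¹ : _) : PadicAlgCl p)‖ = 1 := by
      rw [← norm_mul, ← Subring.coe_mul]
      change ‖(((u * u⁻¹ : (Valued.v (R := PadicAlgCl p)).valuationSubringˣ) :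
        (Valued.v (R := PadicAlgCl p)).valuationSubring) : PadicAlgCl p)‖ = 1
      rw [mul_inv_cancel, Units.val_one, OneMemClass.coe_one, norm_one]
    have h2 : ‖((u⁻¹ : _) : PadicAlgCl p)‖ ≤ 1 :=
      (PadicAlgCl.mem_valuationSubring_iff p _).1 (u⁻¹).1.2
    have h3 : ‖((u : (Valued.v (R := PadicAlgCl p)).valuationSubring) : PadicAlgCl p)‖ *
        ‖((u⁻¹ : _) : PadicAlgCl p)‖ ≤
        ‖((u : (Valued.v (R := PadicAlgCl p)).valuationSubring) : PadicAlgCl p)‖ * 1 :=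
      mul_le_mul_of_nonneg_left h2 (norm_nonneg _)
    rw [h1, mul_one] at h3
    exact absurd h (not_lt.2 h3)

/-- **Algebraic integers of `ℚ̄_p` have norm at most one**: the valuation ring of the
(spectral) `p`-adic norm is integrally closed and contains `ℤ`. [folklore] -/
theorem PadicAlgCl.norm_le_one_of_isIntegral {x : PadicAlgCl p} (hx : IsIntegral ℤ x) :
    ‖x‖ ≤ 1 := by
  have hv := Valuation.integer.integers (Valued.v (R := PadicAlgCl p))
  have hx' : IsIntegral (Valued.v (R := PadicAlgCl p)).integer x := hx.tower_top
  have h := (hv.isIntegral_iff_v_le_one).mp hx'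
  rw [PadicAlgCl.valuation_def] at h
  exact_mod_cast h

/-- The prime `p` lies in the open unit ball of `ℚ̄_p`: `‖p‖ = p⁻¹ < 1`. [folklore] -/
theorem PadicAlgCl.norm_natCast_p_lt_one : ‖(p : PadicAlgCl p)‖ < 1 := by
  rw [← map_natCast (algebraMap ℚ_[p] (PadicAlgCl p)) p, PadicAlgCl.norm_extends]
  exact Padic.norm_p_lt_one

/-- **The residue field of `ℤ̄_p` has characteristic `p`** (`‖p‖ < 1`). [folklore] -/
theorem PadicAlgCl.charP_residueField :
    CharP (IsLocalRing.ResidueField (Valued.v (R := PadicAlgCl p)).valuationSubring) p := by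
  have hp0 : (IsLocalRing.residue (Valued.v (R := PadicAlgCl p)).valuationSubring)
      (p : (Valued.v (R := PadicAlgCl p)).valuationSubring) = 0 := by
    rw [IsLocalRing.residue_eq_zero_iff, PadicAlgCl.mem_maximalIdeal_iff]
    simpa using PadicAlgCl.norm_natCast_p_lt_one p
  exact (CharP.charP_iff_prime_eq_zero Fact.out).2 (by simpa using hp0)

/-- **Frobenius is injective on the residue field of `ℤ̄_p`**: for `u, v` in the valuation
ring, `u ^ p ≡ v ^ p` modulo the maximal ideal forces `u ≡ v` (the residue field has
characteristic `p`, where `(u - v)^p = u^p - v^p`, and is reduced). [folklore] -/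
theorem PadicAlgCl.norm_sub_lt_one_of_norm_pow_sub_pow_lt_one {u v : PadicAlgCl p}
    (hu : ‖u‖ ≤ 1) (hv : ‖v‖ ≤ 1) (h : ‖u ^ p - v ^ p‖ < 1) : ‖u - v‖ < 1 := by
  set O := (Valued.v (R := PadicAlgCl p)).valuationSubring with hO
  let u' : O := ⟨u, (PadicAlgCl.mem_valuationSubring_iff p u).2 hu⟩
  let v' : O := ⟨v, (PadicAlgCl.mem_valuationSubring_iff p v).2 hv⟩
  haveI : CharP (IsLocalRing.ResidueField O) p := PadicAlgCl.charP_residueField p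
  have hred : IsLocalRing.residue O (u' ^ p - v' ^ p) = 0 := by
    rw [IsLocalRing.residue_eq_zero_iff, PadicAlgCl.mem_maximalIdeal_iff]
    simpa [u', v'] using h
  have hzero : (IsLocalRing.residue O u' - IsLocalRing.residue O v') ^ p = 0 := by
    rw [sub_pow_char, ← map_pow, ← map_pow, ← map_sub, hred]
  have huv : IsLocalRing.residue O (u' - v') = 0 := by
    rw [map_sub]; exact pow_eq_zero_iff (Nat.Prime.ne_zero Fact.out) |>.1 hzero
  rw [IsLocalRing.residue_eq_zero_iff, PadicAlgCl.mem_maximalIdeal_iff] at huv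
  simpa [u', v'] using huv

end PadicAlgClIntegers

/-! ### Embeddings into `ℚ̄_p` congruent modulo `𝔪` coincide when `p` is unramified -/

section Unramified

variable {p : ℕ} [Fact p.Prime] {L : Type*} [Field L] [NumberField L]

/-- **Two `p`-adic embeddings of a number field which are congruent modulo the maximal ideal of
`ℤ̄_p` on the integers are equal, when `p` is unramified.**  Let `p ∤ disc L` and let
`b, c : L →+* ℚ̄_p` satisfy `‖b x - c x‖ < 1` for all `x ∈ 𝓞 L`.  Then `b = c`.
Proof: `b` and `c` cut out the same prime `𝔭 ∣ p` of `𝓞 L` and extend to the localisation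
`(𝓞 L)_𝔭 → ℤ̄_p`; `𝓞 L` being a finite `ℤ`-module, `‖b x - c x‖ ≤ r` on `𝓞 L` for some `r < 1`,
i.e. the two extensions agree modulo the ideal `I = {‖y‖ ≤ r}` of `ℤ̄_p`, whose powers
`Iⁿ ⊆ {‖y‖ ≤ rⁿ}` have zero intersection; `(𝓞 L)_𝔭` is formally unramified over `ℤ`
(Dedekind's discriminant theorem, Mathlib `NumberField.not_dvd_discr_iff_forall_mem`), so the
two extensions are equal (`Algebra.FormallyUnramified.ext_of_iInf`), hence `b = c` on `𝓞 L`
and on its fraction field `L`.  (Classically: the embeddings of an unramified local extension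
are determined by their reductions, Hensel.) [folklore] -/
theorem ringHom_padicAlgCl_ext_of_forall_norm_sub_lt_one (hp : ¬ (p : ℤ) ∣ NumberField.discr L)
    (b c : L →+* PadicAlgCl p) (h : ∀ x : 𝓞 L, ‖b x - c x‖ < 1) : b = c := by
  classical
  set O := (Valued.v (R := PadicAlgCl p)).valuationSubring with hOdef
  have hO : ∀ y : PadicAlgCl p, y ∈ O ↔ ‖y‖ ≤ 1 := PadicAlgCl.mem_valuationSubring_iff p
  -- `b` and `c` map `𝓞 L` into `O`
  have hbO : ∀ x : 𝓞 L, (b.comp (algebraMap (𝓞 L) L)) x ∈ O := fun x ↦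
    (hO _).2 (PadicAlgCl.norm_le_one_of_isIntegral p
      ((RingOfIntegers.isIntegral_coe x).map b.toIntAlgHom))
  have hcO : ∀ x : 𝓞 L, (c.comp (algebraMap (𝓞 L) L)) x ∈ O := fun x ↦
    (hO _).2 (PadicAlgCl.norm_le_one_of_isIntegral p
      ((RingOfIntegers.isIntegral_coe x).map c.toIntAlgHom))
  let b₁ : 𝓞 L →+* O := (b.comp (algebraMap (𝓞 L) L)).codRestrict O hbO
  let c₁ : 𝓞 L →+* O := (c.comp (algebraMap (𝓞 L) L)).codRestrict O hcO
  have hb₁ : ∀ x : 𝓞 L, ((b₁ x : O) : PadicAlgCl p) = b x := fun x ↦ rfl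
  have hc₁ : ∀ x : 𝓞 L, ((c₁ x : O) : PadicAlgCl p) = c x := fun x ↦ rfl
  -- the common prime `𝔭` above `p`
  let 𝔭 : Ideal (𝓞 L) := (IsLocalRing.maximalIdeal O).comap b₁
  haveI h𝔭 : 𝔭.IsPrime := Ideal.IsPrime.comap b₁
  have hmem𝔭 : ∀ x : 𝓞 L, x ∈ 𝔭 ↔ ‖b x‖ < 1 := fun x ↦ by
    change b₁ x ∈ IsLocalRing.maximalIdeal O ↔ _
    rw [PadicAlgCl.mem_maximalIdeal_iff]
    rfl
  have hna := PadicAlgCl.isNonarchimedean p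
  -- `‖c x‖ < 1 ↔ ‖b x‖ < 1`
  have hmem𝔭' : ∀ x : 𝓞 L, x ∈ 𝔭 ↔ ‖c x‖ < 1 := fun x ↦ by
    rw [hmem𝔭]
    constructor
    · intro hb
      have : c x = b x + -(b x - c x) := by ring
      rw [this]
      exact (hna _ _).trans_lt (max_lt hb (by rw [norm_neg]; exact h x))
    · intro hc
      have : b x = (b x - c x) + c x := by ring
      rw [this]
      exact (hna _ _).trans_lt (max_lt (h x) hc)
  -- `p ∈ 𝔭`, so `𝔭` is unramified over `ℤ`
  have hp𝔭 : ((p : ℤ) : 𝓞 L) ∈ 𝔭 := by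
    rw [hmem𝔭]
    simpa using PadicAlgCl.norm_natCast_p_lt_one p
  have hpZ : Prime (p : ℤ) := Nat.prime_iff_prime_int.mp Fact.out
  haveI hunr : Algebra.IsUnramifiedAt ℤ 𝔭 :=
    (NumberField.not_dvd_discr_iff_forall_mem L (𝓞 L) hpZ).mp hp 𝔭 h𝔭 hp𝔭
  -- extend `b₁, c₁` to the localisation at `𝔭`
  have hunitb : ∀ y : 𝔭.primeCompl, IsUnit (b₁ y) := fun y ↦ by
    have hy : (y : 𝓞 L) ∉ 𝔭 := y.2
    by_contra hnu
    exact hy ((IsLocalRing.mem_maximalIdeal _).2 (mem_nonunits_iff.2 hnu))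
  have hunitc : ∀ y : 𝔭.primeCompl, IsUnit (c₁ y) := fun y ↦ by
    have hy : (y : 𝓞 L) ∉ 𝔭 := y.2
    rw [hmem𝔭'] at hy
    by_contra hnu
    have hmax : c₁ y ∈ IsLocalRing.maximalIdeal O :=
      (IsLocalRing.mem_maximalIdeal _).2 (mem_nonunits_iff.2 hnu)
    rw [PadicAlgCl.mem_maximalIdeal_iff] at hmax
    exact hy hmax
  set A := Localization.AtPrime 𝔭 with hAdef
  let gb : A →+* O := IsLocalization.lift (M := 𝔭.primeCompl) (g := b₁) hunitb
  let gc : A →+* O := IsLocalization.lift (M := 𝔭.primeCompl) (g := c₁) hunitc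
  have hgb : ∀ x : 𝓞 L, gb (algebraMap (𝓞 L) A x) = b₁ x := fun x ↦
    IsLocalization.lift_eq (M := 𝔭.primeCompl) hunitb x
  have hgc : ∀ x : 𝓞 L, gc (algebraMap (𝓞 L) A x) = c₁ x := fun x ↦
    IsLocalization.lift_eq (M := 𝔭.primeCompl) hunitc x
  let gb' : A →ₐ[ℤ] O :=
    { gb with commutes' := fun n ↦ by simp }
  let gc' : A →ₐ[ℤ] O :=
    { gc with commutes' := fun n ↦ by simp }
  -- a radius `r < 1` with `‖b x - c x‖ ≤ r` on `𝓞 L`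
  obtain ⟨s, hs⟩ := (Module.Finite.fg_top : (⊤ : Submodule ℤ (𝓞 L)).FG)
  let r : ℝ≥0 := s.sup fun x ↦ ‖b x - c x‖₊
  have hr1 : r < 1 := by
    refine (Finset.sup_lt_iff (bot_lt_iff_ne_bot.2 one_ne_zero)).2 fun x _ ↦ ?_
    have := h x
    rw [← coe_nnnorm] at this
    exact_mod_cast this
  -- the ideal `I = {‖y‖ ≤ r}` of `O`
  let I : Ideal O :=
    { carrier := {y | ‖(y : PadicAlgCl p)‖ ≤ r}
      add_mem' := fun {y z} hy hz ↦ by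
        change ‖((y + z : O) : PadicAlgCl p)‖ ≤ r
        rw [Subring.coe_add]
        exact (hna _ _).trans (max_le hy hz)
      zero_mem' := by
        change ‖((0 : O) : PadicAlgCl p)‖ ≤ r
        rw [ZeroMemClass.coe_zero, norm_zero]
        exact r.2
      smul_mem' := fun a y hy ↦ by
        change ‖((a * y : O) : PadicAlgCl p)‖ ≤ r
        rw [Subring.coe_mul, norm_mul]
        calc ‖(a : PadicAlgCl p)‖ * ‖(y : PadicAlgCl p)‖
            ≤ 1 * ‖(y : PadicAlgCl p)‖ :=
              mul_le_mul_of_nonneg_right ((hO _).1 a.2) (norm_nonneg _)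
          _ ≤ r := by rw [one_mul]; exact hy }
  have hmemI : ∀ y : O, y ∈ I ↔ ‖(y : PadicAlgCl p)‖ ≤ r := fun y ↦ Iff.rfl
  -- powers of `I` shrink to zero
  have hpow : ∀ n : ℕ, ∀ y ∈ I ^ n, ‖(y : PadicAlgCl p)‖ ≤ (r : ℝ) ^ n := by
    intro n
    induction n with
    | zero =>
      intro y _
      rw [pow_zero]
      exact (hO _).1 y.2
    | succ n ih =>
      intro y hy
      rw [pow_succ] at hy
      refine Submodule.mul_induction_on hy (fun m hm z hz ↦ ?_) (fun y z hy hz ↦ ?_)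
      · rw [Subring.coe_mul, norm_mul, pow_succ]
        exact mul_le_mul (ih m hm) ((hmemI z).1 hz) (norm_nonneg _) (pow_nonneg r.2 n)
      · rw [Subring.coe_add]
        exact (hna _ _).trans (max_le hy hz)
  have hI : ⨅ n : ℕ, I ^ n = ⊥ := by
    rw [eq_bot_iff]
    intro y hy
    rw [Submodule.mem_iInf] at hy
    rw [Submodule.mem_bot]
    by_contra hy0
    have hpos : 0 < ‖(y : PadicAlgCl p)‖ :=
      norm_pos_iff.2 (fun h0 ↦ hy0 (Subtype.ext h0))
    obtain ⟨n, hn⟩ := exists_pow_lt_of_lt_one hpos (show (r : ℝ) < 1 by exact_mod_cast hr1)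
    exact absurd (hpow n y (hy n)) (not_le.2 hn)
  -- `gb' ≡ gc'` modulo `I`
  have hdiff : ∀ x : 𝓞 L, b₁ x - c₁ x ∈ I := by
    have key : ∀ x ∈ Submodule.span ℤ (s : Set (𝓞 L)), b₁ x - c₁ x ∈ I := by
      intro x hx
      induction hx using Submodule.span_induction with
      | mem x hxs =>
        rw [hmemI, AddSubgroupClass.coe_sub, hb₁, hc₁, ← coe_nnnorm]
        have hle : ‖b x - c x‖₊ ≤ r := by
          change ‖b x - c x‖₊ ≤ s.sup (fun x : 𝓞 L ↦ ‖b x - c x‖₊)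
          exact Finset.le_sup (s := s) (f := fun x : 𝓞 L ↦ ‖b x - c x‖₊)
            (Finset.mem_coe.mp hxs)
        exact_mod_cast hle
      | zero => simp
      | add x y _ _ hx hy =>
        have : b₁ (x + y) - c₁ (x + y) = (b₁ x - c₁ x) + (b₁ y - c₁ y) := by
          rw [map_add, map_add]; ring
        rw [this]
        exact I.add_mem hx hy
      | smul a x _ hx =>
        have : b₁ (a • x) - c₁ (a • x) = a • (b₁ x - c₁ x) := by
          rw [map_zsmul, map_zsmul, smul_sub]
        rw [this]
        exact zsmul_mem hx a
    intro x
    exact key x (hs ▸ Submodule.mem_top)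
  have hagree : ∀ a : A, Ideal.Quotient.mk I (gb' a) = Ideal.Quotient.mk I (gc' a) := by
    have hext : (Ideal.Quotient.mk I).comp gb = (Ideal.Quotient.mk I).comp gc := by
      refine IsLocalization.ringHom_ext 𝔭.primeCompl ?_
      ext x
      change Ideal.Quotient.mk I (gb (algebraMap (𝓞 L) A x)) =
        Ideal.Quotient.mk I (gc (algebraMap (𝓞 L) A x))
      rw [hgb, hgc, Ideal.Quotient.eq]
      exact hdiff x
    intro a
    exact RingHom.congr_fun hext a
  have hgg : gb' = gc' := Algebra.FormallyUnramified.ext_of_iInf I hI hagree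
  -- conclude on `𝓞 L`, then on `L`
  have hOL : ∀ x : 𝓞 L, b x = c x := fun x ↦ by
    have h1 : gb' (algebraMap (𝓞 L) A x) = gc' (algebraMap (𝓞 L) A x) := by rw [hgg]
    change gb (algebraMap (𝓞 L) A x) = gc (algebraMap (𝓞 L) A x) at h1
    rw [hgb, hgc] at h1
    rw [← hb₁, ← hc₁, h1]
  refine IsLocalization.ringHom_ext (nonZeroDivisors (𝓞 L)) (S := L) ?_
  ext x
  exact hOL x

end Unramified

/-! ### Counting embeddings: the reduction map is a bijection -/

section Counting

variable {p : ℕ} [Fact p.Prime] {L : Type*} [Field L] [NumberField L]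

/-- A number field of degree `n` has exactly `n` embeddings into `ℚ̄_p` (algebraically closed
of characteristic zero; Mathlib `AlgHom.card`). [folklore] -/
theorem natCard_ringHom_padicAlgCl : Nat.card (L →+* PadicAlgCl p) = Module.finrank ℚ L := by
  classical
  rw [Nat.card_congr (RingHom.equivRatAlgHom : (L →+* PadicAlgCl p) ≃ _),
    Nat.card_eq_fintype_card]
  exact AlgHom.card ℚ L (PadicAlgCl p)

omit [NumberField L] in
/-- Ring homomorphisms out of `𝓞 L` are the `ℤ`-algebra homomorphisms (`RingHom.toIntAlgHom`
is injective). [folklore] -/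
theorem RingOfIntegers.toIntAlgHom_injective (k : Type*) [CommRing k] :
    Function.Injective (fun f : 𝓞 L →+* k ↦ f.toIntAlgHom) := by
  intro f g hfg
  ext x
  have := DFunLike.congr_fun hfg x
  simpa using this

/-- There are finitely many ring homomorphisms from `𝓞 L` to a domain (Dedekind's
independence of characters; Mathlib `Finite.algHom`). [folklore] -/
theorem finite_ringHom_ringOfIntegers (k : Type*) [CommRing k] [IsDomain k] :
    Finite (𝓞 L →+* k) :=
  Finite.of_injective _ (RingOfIntegers.toIntAlgHom_injective k)

/-- A number field of degree `n` admits at most `n` ring homomorphisms from its integers to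
any domain `k` (Dedekind's independence of characters over `ℤ`: Mathlib
`card_algHom_le_finrank`, with `rank_ℤ 𝓞 L = [L : ℚ]`). [folklore] -/
theorem natCard_ringHom_ringOfIntegers_le (k : Type*) [CommRing k] [IsDomain k] :
    Nat.card (𝓞 L →+* k) ≤ Module.finrank ℚ L := by
  calc Nat.card (𝓞 L →+* k) ≤ Nat.card (𝓞 L →ₐ[ℤ] k) :=
        Nat.card_le_card_of_injective _ (RingOfIntegers.toIntAlgHom_injective k)
    _ ≤ Module.finrank ℤ (𝓞 L) := card_algHom_le_finrank ℤ (𝓞 L) k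
    _ = Module.finrank ℚ L := RingOfIntegers.rank L

/-- **Existence of the Frobenius twist** (`p` unramified in `L`): every embedding
`β : L →+* ℂ` has a Frobenius twist `γ` read through `ι`, i.e. `γ̄ = σ ∘ β̄` on `𝓞 L`.
Proof by counting: reduction `e ↦ ē : (L →+* ℚ̄_p) → (𝓞 L →+* ℤ̄_p/𝔪)` is injective
(`ringHom_padicAlgCl_ext_of_forall_norm_sub_lt_one`), its source has `[L:ℚ]` elements
(`natCard_ringHom_padicAlgCl`) and its target at most `[L:ℚ]`
(`natCard_ringHom_ringOfIntegers_le`), so it is a bijection, and `σ ∘ (ι⁻¹ ∘ β)‾` has a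
preimage.  This is the identification `Σ ≃ {F → ℚ̄_p} ≃ Hom(𝓞_F/(p), 𝔽)` of ERX §3.1 (first
paragraph), `σ` acting on the last set. [cite: EmertonReduzziXiao2017, §3.1 (first paragraph)] -/
theorem exists_isFrobeniusTwist (hp : ¬ (p : ℤ) ∣ NumberField.discr L) (ι : PadicAlgCl p ≃+* ℂ)
    (β : L →+* ℂ) : ∃ γ : L →+* ℂ, IsFrobeniusTwist p ι β γ := by
  classical
  set O := (Valued.v (R := PadicAlgCl p)).valuationSubring with hOdef
  have hO : ∀ y : PadicAlgCl p, y ∈ O ↔ ‖y‖ ≤ 1 := PadicAlgCl.mem_valuationSubring_iff p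
  have hint : ∀ (e : L →+* PadicAlgCl p) (x : 𝓞 L), (e.comp (algebraMap (𝓞 L) L)) x ∈ O :=
    fun e x ↦ (hO _).2 (PadicAlgCl.norm_le_one_of_isIntegral p
      ((RingOfIntegers.isIntegral_coe x).map e.toIntAlgHom))
  let res : (L →+* PadicAlgCl p) → (𝓞 L →+* O) := fun e ↦
    (e.comp (algebraMap (𝓞 L) L)).codRestrict O (hint e)
  have hres : ∀ (e : L →+* PadicAlgCl p) (x : 𝓞 L), ((res e x : O) : PadicAlgCl p) = e x :=
    fun _ _ ↦ rfl
  let Φ : (L →+* PadicAlgCl p) → (𝓞 L →+* IsLocalRing.ResidueField O) := fun e ↦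
    (IsLocalRing.residue O).comp (res e)
  -- `Φ` is injective
  have hΦ : Function.Injective Φ := by
    intro e₁ e₂ h12
    refine ringHom_padicAlgCl_ext_of_forall_norm_sub_lt_one hp e₁ e₂ fun x ↦ ?_
    have hx : IsLocalRing.residue O (res e₁ x) = IsLocalRing.residue O (res e₂ x) :=
      RingHom.congr_fun h12 x
    rw [← sub_eq_zero, ← map_sub, IsLocalRing.residue_eq_zero_iff,
      PadicAlgCl.mem_maximalIdeal_iff, AddSubgroupClass.coe_sub, hres, hres] at hx
    exact hx
  -- hence bijective, by counting
  haveI : Finite (𝓞 L →+* IsLocalRing.ResidueField O) := finite_ringHom_ringOfIntegers _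
  have hbij : Function.Bijective Φ := by
    refine hΦ.bijective_of_nat_card_le ?_
    rw [natCard_ringHom_padicAlgCl]
    exact natCard_ringHom_ringOfIntegers_le _
  -- the Frobenius twist of the reduction of `ι⁻¹ ∘ β` has a preimage
  haveI : CharP (IsLocalRing.ResidueField O) p := PadicAlgCl.charP_residueField p
  let eβ : L →+* PadicAlgCl p := (ι.symm : ℂ ≃+* PadicAlgCl p).toRingHom.comp β
  obtain ⟨e, he⟩ := hbij.2 ((frobenius (IsLocalRing.ResidueField O) p).comp (Φ eβ))
  refine ⟨(ι : PadicAlgCl p ≃+* ℂ).toRingHom.comp e, fun x hx ↦ ?_⟩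
  let x' : 𝓞 L := ⟨x, hx⟩
  have key : IsLocalRing.residue O (res e x') = (IsLocalRing.residue O (res eβ x')) ^ p := by
    have := RingHom.congr_fun he x'
    simpa [Φ, frobenius_def] using this
  rw [← map_pow, ← sub_eq_zero, ← map_sub, IsLocalRing.residue_eq_zero_iff,
    PadicAlgCl.mem_maximalIdeal_iff, AddSubgroupClass.coe_sub, SubmonoidClass.coe_pow, hres,
    hres] at key
  change ‖ι.symm (ι (e x)) - (ι.symm (β x)) ^ p‖ < 1
  rw [RingEquiv.symm_apply_apply]
  exact key

/-- **The Frobenius permutation exists** (`p` unramified in `L`): there is a function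
`Fr : (L →+* ℂ) → (L →+* ℂ)` with `IsFrobeniusTwist p ι β (Fr β)` for every `β` — the datum
quantified in `HilbertPartialHasseWeightShifting`; it is unique and bijective
(`IsFrobeniusTwist.unique`, `bijective_of_forall_isFrobeniusTwist`).
[cite: EmertonReduzziXiao2017, §3.1 (first paragraph)] -/
theorem exists_forall_isFrobeniusTwist (hp : ¬ (p : ℤ) ∣ NumberField.discr L)
    (ι : PadicAlgCl p ≃+* ℂ) :
    ∃ Fr : (L →+* ℂ) → (L →+* ℂ), ∀ β : L →+* ℂ, IsFrobeniusTwist p ι β (Fr β) :=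
  ⟨fun β ↦ (exists_isFrobeniusTwist hp ι β).choose,
    fun β ↦ (exists_isFrobeniusTwist hp ι β).choose_spec⟩

end Counting

/-! ### Consequences for `IsFrobeniusTwist` -/

section FrobeniusTwist

variable {p : ℕ} [Fact p.Prime] {L : Type*} [Field L] [NumberField L]

omit [NumberField L] in
/-- Restricting the congruence of a Frobenius twist to the ring of integers `𝓞 L`
(whose elements are the `ℤ`-integral elements of `L`). [folklore] -/
theorem IsFrobeniusTwist.norm_sub_pow_lt_one {ι : PadicAlgCl p ≃+* ℂ} {β γ : L →+* ℂ}
    (h : IsFrobeniusTwist p ι β γ) (x : 𝓞 L) :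
    ‖ι.symm (γ x) - ι.symm (β x) ^ p‖ < 1 :=
  h x (RingOfIntegers.isIntegral_coe x)

/-- **Uniqueness of the Frobenius twist** (`p` unramified in `L`): if `γ` and `γ'` are both
Frobenius twists of `β` read through `ι`, then `γ = γ'` — their `p`-adic avatars
`ι⁻¹ ∘ γ, ι⁻¹ ∘ γ'` are congruent modulo `𝔪` on `𝓞 L`
(`ringHom_padicAlgCl_ext_of_forall_norm_sub_lt_one`).  ERX §3.1 (identification of `Σ` with
the `p`-adic embeddings). [cite: EmertonReduzziXiao2017, §3.1 (first paragraph)] -/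
theorem IsFrobeniusTwist.unique (hp : ¬ (p : ℤ) ∣ NumberField.discr L) {ι : PadicAlgCl p ≃+* ℂ}
    {β γ γ' : L →+* ℂ} (h : IsFrobeniusTwist p ι β γ) (h' : IsFrobeniusTwist p ι β γ') :
    γ = γ' := by
  have hna := PadicAlgCl.isNonarchimedean p
  have key := ringHom_padicAlgCl_ext_of_forall_norm_sub_lt_one hp
    ((ι.symm : ℂ ≃+* PadicAlgCl p).toRingHom.comp γ)
    ((ι.symm : ℂ ≃+* PadicAlgCl p).toRingHom.comp γ') (fun x ↦ by
      change ‖ι.symm (γ x) - ι.symm (γ' x)‖ < 1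
      have : ι.symm (γ x) - ι.symm (γ' x) =
          (ι.symm (γ x) - ι.symm (β x) ^ p) + -(ι.symm (γ' x) - ι.symm (β x) ^ p) := by ring
      rw [this]
      exact (hna _ _).trans_lt (max_lt (h.norm_sub_pow_lt_one x)
        (by rw [norm_neg]; exact h'.norm_sub_pow_lt_one x)))
  ext x
  have := RingHom.congr_fun key x
  simpa using this

/-- **The Frobenius twist determines the embedding** (`p` unramified in `L`): if `γ` is a
Frobenius twist of both `β` and `β'`, then `β = β'` — modulo `𝔪`, `β(x)^p ≡ β'(x)^p`, and
Frobenius is injective on the residue field of `ℤ̄_p`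
(`PadicAlgCl.norm_sub_lt_one_of_norm_pow_sub_pow_lt_one`), so `β ≡ β'` and
`ringHom_padicAlgCl_ext_of_forall_norm_sub_lt_one` applies. [cite: EmertonReduzziXiao2017, §3.1 (first paragraph)] -/
theorem IsFrobeniusTwist.eq_of_eq (hp : ¬ (p : ℤ) ∣ NumberField.discr L)
    {ι : PadicAlgCl p ≃+* ℂ} {β β' γ : L →+* ℂ} (h : IsFrobeniusTwist p ι β γ)
    (h' : IsFrobeniusTwist p ι β' γ) : β = β' := by
  have hna := PadicAlgCl.isNonarchimedean p
  have key := ringHom_padicAlgCl_ext_of_forall_norm_sub_lt_one hp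
    ((ι.symm : ℂ ≃+* PadicAlgCl p).toRingHom.comp β)
    ((ι.symm : ℂ ≃+* PadicAlgCl p).toRingHom.comp β') (fun x ↦ by
      change ‖ι.symm (β x) - ι.symm (β' x)‖ < 1
      have hβ : ‖ι.symm (β x)‖ ≤ 1 := PadicAlgCl.norm_le_one_of_isIntegral p
        ((RingOfIntegers.isIntegral_coe x).map
          ((ι.symm : ℂ ≃+* PadicAlgCl p).toRingHom.comp β).toIntAlgHom)
      have hβ' : ‖ι.symm (β' x)‖ ≤ 1 := PadicAlgCl.norm_le_one_of_isIntegral p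
        ((RingOfIntegers.isIntegral_coe x).map
          ((ι.symm : ℂ ≃+* PadicAlgCl p).toRingHom.comp β').toIntAlgHom)
      refine PadicAlgCl.norm_sub_lt_one_of_norm_pow_sub_pow_lt_one p hβ hβ' ?_
      have : ι.symm (β x) ^ p - ι.symm (β' x) ^ p =
          (ι.symm (γ x) - ι.symm (β' x) ^ p) + -(ι.symm (γ x) - ι.symm (β x) ^ p) := by ring
      rw [this]
      exact (hna _ _).trans_lt (max_lt (h'.norm_sub_pow_lt_one x)
        (by rw [norm_neg]; exact h.norm_sub_pow_lt_one x)))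
  ext x
  have := RingHom.congr_fun key x
  simpa using this

/-- **A Frobenius-twist function is injective** (`p` unramified): if `Fr β` is a Frobenius
twist of `β` for every embedding `β : L →+* ℂ`, then `Fr` is injective. [cite: EmertonReduzziXiao2017, §3.1 (first paragraph)] -/
theorem injective_of_forall_isFrobeniusTwist (hp : ¬ (p : ℤ) ∣ NumberField.discr L)
    {ι : PadicAlgCl p ≃+* ℂ} {Fr : (L →+* ℂ) → (L →+* ℂ)}
    (hFr : ∀ β : L →+* ℂ, IsFrobeniusTwist p ι β (Fr β)) : Function.Injective Fr :=
  fun β β' hββ' ↦ (hFr β).eq_of_eq hp (hββ' ▸ hFr β')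

/-- **A Frobenius-twist function is a permutation of the embeddings** (`p` unramified): the
`Fr` of the hypothesis of `HilbertPartialHasseWeightShifting` is a bijection of the finite set
`L →+* ℂ` — the arithmetic Frobenius `σ` permutes `Σ ≃ (L →+* ℂ)`.
[cite: EmertonReduzziXiao2017, §3.1 (first paragraph)] -/
theorem bijective_of_forall_isFrobeniusTwist (hp : ¬ (p : ℤ) ∣ NumberField.discr L)
    {ι : PadicAlgCl p ≃+* ℂ} {Fr : (L →+* ℂ) → (L →+* ℂ)}
    (hFr : ∀ β : L →+* ℂ, IsFrobeniusTwist p ι β (Fr β)) : Function.Bijective Fr :=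
  Finite.injective_iff_bijective.mp (injective_of_forall_isFrobeniusTwist hp hFr)

/-- **Total weight of the shift.**  For `Fr` as in `HilbertPartialHasseWeightShifting` (hence a
permutation) and any `M`, `Σ_β (p·M (Fr β) - M β) = (p - 1)·Σ_β M β`: the parallel degree of
`∏_τ h_τ^{M_τ}` is `(p-1) Σ M_τ`, as `Σ_τ (p e_{Fr⁻¹ τ} - e_τ) = (p-1)·1` (total Hasse
invariant). [cite: EmertonReduzziXiao2017, §3.1 (total Hasse invariant)] -/
theorem sum_weightShift_eq (hp : ¬ (p : ℤ) ∣ NumberField.discr L)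
    {ι : PadicAlgCl p ≃+* ℂ} {Fr : (L →+* ℂ) → (L →+* ℂ)}
    (hFr : ∀ β : L →+* ℂ, IsFrobeniusTwist p ι β (Fr β)) (M : (L →+* ℂ) → ℕ) :
    ∑ β, ((p : ℤ) * M (Fr β) - M β) = ((p : ℤ) - 1) * ∑ β, (M β : ℤ) := by
  classical
  have hbij := bijective_of_forall_isFrobeniusTwist hp hFr
  rw [Finset.sum_sub_distrib, ← Finset.mul_sum, sub_one_mul]
  congr 1
  congr 1
  exact Function.Bijective.sum_comp hbij (fun β ↦ (M β : ℤ))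

end FrobeniusTwist

/-! ### A Frobenius-free corollary of the named fact: parallel weight shifting -/

section Parallel

open IsDedekindDomain

/-- **Parallel weight shifting modulo `p`** — the case `M = 0` of
`HilbertPartialHasseWeightShifting` (even powers `h^{2n}` of the total Hasse invariant only,
weight `(p-1)·1` each; Buzzard–Diamond–Jarvis 2010, proof of Cor. 2.6, and ERX §4.2–4.3 for
the lifting), in which the Frobenius permutation no longer enters the weight and is
discharged by `exists_forall_isFrobeniusTwist`: for `π` cuspidal on `GL₂(𝔸_L)` (`L` totally
real, `[L:ℚ] > 1`), holomorphic of paritious weight `(k, w)` with `k_β ≥ 2`, unramified above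
the prime `p ∤ disc L`, there is `n₀` such that for every `n ≥ n₀` some cuspidal `π'`,
holomorphic of weight `(k + 2n(p-1)·1, w)` and unramified above `p`, is congruent to `π`
modulo the maximal ideal of `ℤ̄_p` at almost all places (coefficientwise congruence of the
Frobenius polynomials `arithFrobPolyOfSatake`).  A theorem CONDITIONAL on the named fact
(hypothesis `hfact`), not a discharge of it. [cite: EmertonReduzziXiao2017, §3.1 and §4.2 Lemma 4.2.2, §4.3]
[cite: BuzzardDiamondJarvis2010, proof of Cor. 2.6] -/
theorem HilbertPartialHasseWeightShifting.parallel (hfact : HilbertPartialHasseWeightShifting)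
    (L : Type) [Field L] [NumberField L] [IsTotallyReal L] (hL : 1 < Module.finrank ℚ L)
    (p : ℕ) [Fact p.Prime] (hp : ¬ (p : ℤ) ∣ NumberField.discr L) (ι : PadicAlgCl p ≃+* ℂ)
    (hcpt : isCompact_glFiniteIntegralLevel 2 L) (π : CuspidalAutomorphicRepData 2 L hcpt)
    (k : (L →+* ℂ) → ℕ) (w : ℤ) (hk : ∀ β : L →+* ℂ, 2 ≤ k β)
    (hpar : ∀ β : L →+* ℂ, (2 : ℤ) ∣ (k β : ℤ) - w) (hπ : π.1.IsHolomorphicHilbert k w)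
    (hunr : ∀ v : HeightOneSpectrum (𝓞 L), ((p : ℕ) : 𝓞 L) ∈ v.asIdeal →
      π.1.IsUnramifiedAt v) :
    ∃ n₀ : ℕ, ∀ n : ℕ, n₀ ≤ n →
      ∃ π' : CuspidalAutomorphicRepData 2 L hcpt,
        π'.1.IsHolomorphicHilbert (fun β ↦ k β + 2 * n * (p - 1)) w ∧
        (∀ v : HeightOneSpectrum (𝓞 L), ((p : ℕ) : 𝓞 L) ∈ v.asIdeal →
            π'.1.IsUnramifiedAt v) ∧
        ∀ᶠ v : HeightOneSpectrum (𝓞 L) in Filter.cofinite, ∃ α α' : Multiset ℂ,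
          π.1.HasSatakeParamAt v α ∧ π'.1.HasSatakeParamAt v α' ∧
            ∀ i : ℕ, ‖(arithFrobPolyOfSatake ι v.residueCard 2 α).coeff i -
                (arithFrobPolyOfSatake ι v.residueCard 2 α').coeff i‖ < 1 := by
  obtain ⟨Fr, hFr⟩ := exists_forall_isFrobeniusTwist (L := L) hp ι
  obtain ⟨n₀, hn₀⟩ := hfact L hL p hp ι Fr hFr hcpt π k w hk hpar hπ hunr (fun _ ↦ 0)
    (fun _ ↦ ⟨0, rfl⟩)
  refine ⟨n₀, fun n hn ↦ ?_⟩
  obtain ⟨k', π', hk', hhol, hunr', hcong⟩ := hn₀ n hn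
  have hk'eq : k' = fun β ↦ k β + 2 * n * (p - 1) := by
    funext β
    have h := hk' β
    have hp1 : 1 ≤ p := (Fact.out : p.Prime).one_lt.le
    simp only [Nat.cast_zero, mul_zero, add_zero, sub_zero] at h
    have h' : (k' β : ℤ) = ((k β + 2 * n * (p - 1) : ℕ) : ℤ) := by
      rw [h]; push_cast [Nat.cast_sub hp1]; ring
    exact_mod_cast h'
  exact ⟨π', hk'eq ▸ hhol, hunr', hcong⟩

end Parallel

end Literature.NumberTheory.Automorphic
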